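/-
Copyright (c) 2026. All rights reserved.
Released under Apache 2.0 license as described in the file LICENSE.
-/
import Literature.NumberTheory.Automorphic.BrandtSetupTypeFibreCardinality
import Literature.NumberTheory.Automorphic.DefiniteOrdersClassNumbersMass
import HarnessLib

/-!
# Eichler's mass formula summed over the types: `2^{ω(N)} · Σ_{t ∈ Typ O} 1/(z_t w_t) = mass(O)` and the type-number bound
# `#Typ O ≥ mass(O)/2^{ω(N)}` (Voight Thm. 25.3.18, Cor. 18.5.12, (18.5.8), Prop. 18.5.10)

[tag: quaternion_algebra] [tag: eichler_order] [tag: class_number]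

Topic `NumberTheory/Automorphic`; THEOREMS ONLY (no definition, no named fact, no instance, no notation; net debt `0`).
Lane `lit-hodgefound`, seat p12, gen 54 — for the Eichler order `O` of a Brandt setup `S : XiSetup N⁺ N⁻` (definite quaternion
algebra over `ℚ` of discriminant `N⁻`, level `N⁺`), on top of the tree's Eichler mass formula `Brandt.XiSetup.massFormula`
(`Σ_c 1/w_c = φ(N⁻)ψ(N⁺)/12`), the type invariance of the weights (`weight_eq_weight_of_typeOf_eq`) and the fibre count
`#{c : typeOf c = t} · z_t = 2^{#T}` of `BrandtSetupTypeFibreCardinality.lean` (`z_t = #{g ∈ (ℤ/2ℤ)^T : O_t P_{supp g}(O_t)`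
principal, counted by norm elements `}` `= [N(O_t) : ℚ^×O_t^×]`).

THE PRINTED STATEMENTS (J. Voight, *Quaternion Algebras*, GTM 288). **Thm. 25.3.18 (Eichler mass formula)**:
`Σ_{[I] ∈ Cls O} 1/w_I = φ(D)ψ(M)/12` over `ℚ`, `w_I = [O_L(I)^× : ℤ^×]`; **Prop. 18.5.10**: the fibre of `Cls O → Typ O` over the
type of `O'` is `PIdl(O') \ Idl(O')`; **(18.5.8)**: `#(Idl(O')/PIdl(O')) · #(N(O')/(F^×O'^×)) = # Pic_R(O') = 2^{ω(N)}`;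
**Cor. 18.5.12**: `#Cls O = Σ_{[O']} [Idl(O') : PIdl(O')]`. Summing the mass formula over the fibres gives the classical
MASS FORMULA BY TYPES: `Σ_{[O'] ∈ Typ O} [Idl(O') : PIdl(O')] / w_{O'} = φ(D)ψ(M)/12`, i.e.
`Σ_{[O']} 1/(z_{O'} w_{O'}) = mass/2^{ω(N)}` — the denominators `z_{O'} w_{O'} = #(N(O')/ℚ^×) = #Aut_ℤ(O')` (Cor. 7.7.4, Remark
18.5.6), so this is `Σ_{[O']} 1/#Aut(O') = mass/2^{ω(N)}`.

With `mass := (1/12) ∏_{q ∣ N⁻} (q-1) ∏_{p^k ∥ N⁺} p^{k-1}(p+1)`, `w` the Brandt weights `weight S.O`, the fibre sizes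
`n_t = #{c : typeOf c = t}` and the type invariants `z_t` (as in `BrandtSetupTypeFibreCardinality.lean`), this file proves:

* §1 **grouping by types: `Σ_c 1/w_c = Σ_t n_t / W(t)`** for any weight function `W` on types with `W(typeOf c) = w_c`
  (`XiSetup.sum_inv_weight_eq_sum_natCard_fibre_div`), hence **`Σ_t n_t / W(t) = mass`**;
* §2 **THE MASS FORMULA BY TYPES: `Σ_t 2^{#T}/(z_t · W(t)) = mass`** for `T ⊇ primes(N⁺N⁻)`
  (`XiSetup.sum_two_pow_div_typeNorm_mul_weight_eq_mass`), and at `T = primes(N⁺N⁻)`: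
  **`Σ_t 1/(z_t · W(t)) = mass / 2^{ω(N⁺N⁻)}`** (`XiSetup.sum_inv_typeNorm_mul_weight_eq_mass_div_two_pow`);
* §3 **TYPE-NUMBER BOUNDS: `Σ_t 1/W(t) ≤ mass ≤ 2^{ω(N⁺N⁻)} · Σ_t 1/W(t)`** (`1 ≤ n_t ≤ 2^{ω}`), hence
  **`mass ≤ 2^{ω(N⁺N⁻)} · #Typ O`** (`XiSetup.mass_le_two_pow_mul_natCard_typeSet`) — every genus of Eichler orders over `ℚ` has
  at least `φ(N⁻)ψ(N⁺)/(12 · 2^{ω(N⁺N⁻)})` types.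

## References

* [Voight2021] J. Voight, *Quaternion Algebras*, GTM 288 (2021): Thm. 25.3.18 (mass formula), Prop. 18.5.10, (18.5.8),
  Cor. 18.5.12, Remark 18.5.6, Cor. 7.7.4.
* [VignerasLNM800] M.-F. Vignéras, *Arithmétique des algèbres de quaternions*, LNM 800 (1980), Ch. V §2 Cor. 2.3 (formule de
  masse), Cor. 2.5.

## Scope (honest)

Theorems only; the weight on types enters as a function `W` with `W(typeOf c) = w_c` (such functions exist by
`weight_eq_weight_of_typeOf_eq`; no `def` is introduced), and `#Aut(O_t) = z_t w_t` is commentary, not a formal statement here.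
-/

noncomputable section

open scoped Pointwise

universe u

namespace Literature.NumberTheory.Automorphic

open AtkinLehner

namespace Brandt

variable {Nplus Nminus : ℕ} (S : XiSetup Nplus Nminus) (T : Finset ℕ)

/-! ## §1 Grouping the mass by types -/

/-- **A weight function on the types exists**: `t ↦ w_c` for any `c` of type `t` is well defined. [cite: Voight2021, Lemma 17.4.13 and 41.1.3] -/
theorem XiSetup.exists_typeWeight : ∃ W : TypeSet S.O → ℕ, ∀ c : ClassSet S.O, W (typeOf S.O c) = weight S.O c := by
  classical
  refine ⟨fun t => weight S.O (typeOf_surjective t).choose, fun c => ?_⟩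
  exact weight_eq_weight_of_typeOf_eq (typeOf_surjective (typeOf S.O c)).choose_spec

omit T in
/-- **`Σ_c 1/w_c = Σ_{t ∈ Typ O} n_t / W(t)`**, `n_t = #{c : typeOf c = t}`, for every weight function `W` on types with
`W(typeOf c) = w_c` (the weight is a type invariant). [cite: Voight2021, Cor. 18.5.12 and Thm. 25.3.18] -/
theorem XiSetup.sum_inv_weight_eq_sum_natCard_fibre_div [Fintype (ClassSet S.O)] [Fintype (TypeSet S.O)] {W : TypeSet S.O → ℕ}
    (hW : ∀ c : ClassSet S.O, W (typeOf S.O c) = weight S.O c) :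
    ∑ c : ClassSet S.O, (1 : ℚ) / weight S.O c =
      ∑ t : TypeSet S.O, (Nat.card {c : ClassSet S.O // typeOf S.O c = t} : ℚ) / W t := by
  classical
  calc ∑ c : ClassSet S.O, (1 : ℚ) / weight S.O c
      = ∑ x : (Σ t : TypeSet S.O, {c : ClassSet S.O // typeOf S.O c = t}), (1 : ℚ) / W x.1 := by
        rw [← (Equiv.sigmaFiberEquiv (typeOf S.O)).sum_comp (fun c => (1 : ℚ) / weight S.O c)]
        refine Finset.sum_congr rfl fun x _ => ?_
        rw [Equiv.sigmaFiberEquiv_apply, ← hW, x.2.2]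
    _ = ∑ t : TypeSet S.O, ∑ _c : {c : ClassSet S.O // typeOf S.O c = t}, (1 : ℚ) / W t := Fintype.sum_sigma _
    _ = ∑ t : TypeSet S.O, (Nat.card {c : ClassSet S.O // typeOf S.O c = t} : ℚ) / W t := by
        refine Finset.sum_congr rfl fun t _ => ?_
        rw [Finset.sum_const, Finset.card_univ, Nat.card_eq_fintype_card, nsmul_eq_mul, mul_one_div]

omit T in
/-- **`Σ_{t ∈ Typ O} n_t / W(t) = mass(O) = φ(N⁻)ψ(N⁺)/12`** (Eichler's mass formula grouped by types).
[cite: Voight2021, Thm. 25.3.18 and Cor. 18.5.12] [cite: VignerasLNM800, Ch. V §2 Cor. 2.3] -/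
theorem XiSetup.sum_natCard_fibre_div_weight_eq_mass [Fintype (ClassSet S.O)] [Fintype (TypeSet S.O)] {W : TypeSet S.O → ℕ}
    (hW : ∀ c : ClassSet S.O, W (typeOf S.O c) = weight S.O c) :
    ∑ t : TypeSet S.O, (Nat.card {c : ClassSet S.O // typeOf S.O c = t} : ℚ) / W t =
      (1 / 12 : ℚ) * (∏ q ∈ Nminus.primeFactors, ((q : ℚ) - 1)) *
        ∏ p ∈ Nplus.primeFactors, (p : ℚ) ^ (Nplus.factorization p - 1) * ((p : ℚ) + 1) := by
  rw [← S.sum_inv_weight_eq_sum_natCard_fibre_div hW, S.massFormula]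

/-! ## §2 The mass formula by types -/

/-- **THE MASS FORMULA BY TYPES: `Σ_{t ∈ Typ O} 2^{#T} / (z_t · W(t)) = mass(O)`** for `T ⊇ primes(N⁺N⁻)`, with the type invariants
`z_t = #{g ∈ (ℤ/2ℤ)^T : O_L(I_c) P_{supp g}(O_L(I_c)) ∋ x, nrd x = ∏ localNorm}` (`c` of type `t`; `= [N(O_t) : ℚ^×O_t^×]`) and the
weights `W(t) = w_c` (`n_t = 2^{#T}/z_t`). [cite: Voight2021, Thm. 25.3.18, Cor. 18.5.12 and (18.5.8)] [cite: VignerasLNM800, Ch. V §2 Cor. 2.3] -/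
theorem XiSetup.sum_two_pow_div_typeNorm_mul_weight_eq_mass [Fintype (ClassSet S.O)] [Fintype (TypeSet S.O)]
    (hT : (Nplus * Nminus).primeFactors ⊆ T) (hTp : ∀ r ∈ T, r.Prime) {W : TypeSet S.O → ℕ}
    (hW : ∀ c : ClassSet S.O, W (typeOf S.O c) = weight S.O c) :
    ∑ t : TypeSet S.O, (2 : ℚ) ^ T.card /
        ((Nat.card {g : T → Multiplicative (ZMod 2) // ∀ c : ClassSet S.O, typeOf S.O c = t →
          ∃ x ∈ leftOrder c.rep * S.twoSidedIdealProd (leftOrder c.rep) (suppSort T g),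
            reducedNorm ℚ S.D x = (((suppSort T g).map (localNorm Nplus Nminus)).prod : ℕ)} : ℚ) * (W t : ℚ)) =
      (1 / 12 : ℚ) * (∏ q ∈ Nminus.primeFactors, ((q : ℚ) - 1)) *
        ∏ p ∈ Nplus.primeFactors, (p : ℚ) ^ (Nplus.factorization p - 1) * ((p : ℚ) + 1) := by
  rw [← S.sum_natCard_fibre_div_weight_eq_mass hW]
  refine Finset.sum_congr rfl fun t _ => ?_
  have key := S.natCard_fibre_mul_natCard_typeNorm_eq_two_pow T hT hTp t
  have hz : (Nat.card {g : T → Multiplicative (ZMod 2) // ∀ c : ClassSet S.O, typeOf S.O c = t →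
      ∃ x ∈ leftOrder c.rep * S.twoSidedIdealProd (leftOrder c.rep) (suppSort T g),
        reducedNorm ℚ S.D x = (((suppSort T g).map (localNorm Nplus Nminus)).prod : ℕ)} : ℚ) ≠ 0 :=
    Nat.cast_ne_zero.mpr (S.natCard_typeNorm_pos T hT hTp t).ne'
  rw [div_mul_eq_div_div]
  congr 1
  rw [div_eq_iff hz]
  exact_mod_cast key.symm

/-- **At `T = primes(N⁺N⁻)`: `2^{ω(N⁺N⁻)} · Σ_{t ∈ Typ O} 1/(z_t · W(t)) = mass(O)`** — with `z_t · w_t = #(N(O_t)/ℚ^×) = #Aut(O_t)`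
this is `Σ_{[O']} 1/#Aut(O') = φ(N⁻)ψ(N⁺)/(12 · 2^{ω(N⁺N⁻)})`. [cite: Voight2021, Thm. 25.3.18, (18.5.8) and Remark 18.5.6] -/
theorem XiSetup.two_pow_mul_sum_inv_typeNorm_mul_weight_eq_mass [Fintype (ClassSet S.O)] [Fintype (TypeSet S.O)]
    {W : TypeSet S.O → ℕ} (hW : ∀ c : ClassSet S.O, W (typeOf S.O c) = weight S.O c) :
    (2 : ℚ) ^ (Nplus * Nminus).primeFactors.card * ∑ t : TypeSet S.O, (1 : ℚ) /
        ((Nat.card {g : ↥(Nplus * Nminus).primeFactors → Multiplicative (ZMod 2) // ∀ c : ClassSet S.O, typeOf S.O c = t →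
          ∃ x ∈ leftOrder c.rep * S.twoSidedIdealProd (leftOrder c.rep) (suppSort (Nplus * Nminus).primeFactors g),
            reducedNorm ℚ S.D x = (((suppSort (Nplus * Nminus).primeFactors g).map (localNorm Nplus Nminus)).prod : ℕ)} : ℚ) *
          (W t : ℚ)) =
      (1 / 12 : ℚ) * (∏ q ∈ Nminus.primeFactors, ((q : ℚ) - 1)) *
        ∏ p ∈ Nplus.primeFactors, (p : ℚ) ^ (Nplus.factorization p - 1) * ((p : ℚ) + 1) := by
  rw [← S.sum_two_pow_div_typeNorm_mul_weight_eq_mass (Nplus * Nminus).primeFactors subset_rfl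
    (fun r hr => (Nat.mem_primeFactors.mp hr).1) hW, Finset.mul_sum]
  refine Finset.sum_congr rfl fun t _ => ?_
  rw [mul_one_div]

/-! ## §3 Type-number bounds from the mass -/

omit T in
/-- **`Σ_{t ∈ Typ O} 1/W(t) ≤ mass(O)`** (every fibre is non-empty). [cite: Voight2021, Thm. 25.3.18 and Cor. 18.5.12] -/
theorem XiSetup.sum_inv_typeWeight_le_mass [Fintype (ClassSet S.O)] [Fintype (TypeSet S.O)] {W : TypeSet S.O → ℕ}
    (hW : ∀ c : ClassSet S.O, W (typeOf S.O c) = weight S.O c) :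
    ∑ t : TypeSet S.O, (1 : ℚ) / W t ≤
      (1 / 12 : ℚ) * (∏ q ∈ Nminus.primeFactors, ((q : ℚ) - 1)) *
        ∏ p ∈ Nplus.primeFactors, (p : ℚ) ^ (Nplus.factorization p - 1) * ((p : ℚ) + 1) := by
  rw [← S.sum_natCard_fibre_div_weight_eq_mass hW]
  refine Finset.sum_le_sum fun t _ => div_le_div_of_nonneg_right ?_ (Nat.cast_nonneg _)
  obtain ⟨c, rfl⟩ := typeOf_surjective t
  exact_mod_cast S.natCard_fibre_typeOf_pos c

omit T in
/-- **`mass(O) ≤ 2^{ω(N⁺N⁻)} · Σ_{t ∈ Typ O} 1/W(t)`** (every fibre has at most `2^{ω(N⁺N⁻)}` classes).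
[cite: Voight2021, Thm. 25.3.18, Prop. 18.5.10 and (23.4.20)] -/
theorem XiSetup.mass_le_two_pow_mul_sum_inv_typeWeight [Fintype (ClassSet S.O)] [Fintype (TypeSet S.O)] {W : TypeSet S.O → ℕ}
    (hW : ∀ c : ClassSet S.O, W (typeOf S.O c) = weight S.O c) :
    (1 / 12 : ℚ) * (∏ q ∈ Nminus.primeFactors, ((q : ℚ) - 1)) *
        ∏ p ∈ Nplus.primeFactors, (p : ℚ) ^ (Nplus.factorization p - 1) * ((p : ℚ) + 1) ≤
      (2 : ℚ) ^ (Nplus * Nminus).primeFactors.card * ∑ t : TypeSet S.O, (1 : ℚ) / W t := by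
  rw [← S.sum_natCard_fibre_div_weight_eq_mass hW, Finset.mul_sum]
  refine Finset.sum_le_sum fun t _ => ?_
  rw [mul_one_div]
  refine div_le_div_of_nonneg_right ?_ (Nat.cast_nonneg _)
  obtain ⟨c, rfl⟩ := typeOf_surjective t
  exact_mod_cast S.natCard_fibre_typeOf_le_two_pow c

omit T in
/-- **THE TYPE NUMBER IS AT LEAST `mass/2^{ω(N⁺N⁻)}`: `φ(N⁻)ψ(N⁺)/12 ≤ 2^{ω(N⁺N⁻)} · #Typ O`** (`w_t ≥ 1`) — every genus of
Eichler orders over `ℚ` in a definite algebra has at least `φ(N⁻)ψ(N⁺)/(12 · 2^{ω(N⁺N⁻)})` isomorphism classes.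
[cite: Voight2021, Thm. 25.3.18, Prop. 18.5.10 and Cor. 18.5.12] -/
theorem XiSetup.mass_le_two_pow_mul_natCard_typeSet [Fintype (ClassSet S.O)] [Fintype (TypeSet S.O)] :
    (1 / 12 : ℚ) * (∏ q ∈ Nminus.primeFactors, ((q : ℚ) - 1)) *
        ∏ p ∈ Nplus.primeFactors, (p : ℚ) ^ (Nplus.factorization p - 1) * ((p : ℚ) + 1) ≤
      (2 : ℚ) ^ (Nplus * Nminus).primeFactors.card * Nat.card (TypeSet S.O) := by
  obtain ⟨W, hW⟩ := S.exists_typeWeight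
  refine (S.mass_le_two_pow_mul_sum_inv_typeWeight hW).trans (mul_le_mul_of_nonneg_left ?_ (pow_nonneg zero_le_two _))
  have h1 : ∀ t : TypeSet S.O, (1 : ℚ) / W t ≤ 1 := fun t => by
    obtain ⟨c, rfl⟩ := typeOf_surjective t
    rw [hW]
    exact div_le_one_of_le₀ (by exact_mod_cast S.one_le_weight c) (Nat.cast_nonneg _)
  calc ∑ t : TypeSet S.O, (1 : ℚ) / W t ≤ ∑ _t : TypeSet S.O, (1 : ℚ) := Finset.sum_le_sum fun t _ => h1 t
    _ = Nat.card (TypeSet S.O) := by rw [Finset.sum_const, Finset.card_univ, Nat.card_eq_fintype_card, nsmul_eq_mul, mul_one]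

end Brandt

end Literature.NumberTheory.Automorphic
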